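import Summits.ResolutionOfSingularities.KangarooAtlas.MizutaniRank
import Mathlib.LinearAlgebra.FiniteDimensional.Lemmas
import HarnessLib

/-!
# Mizutani's conjecture `m(e) = 2p^e − 1` — support reduction and the rank of a short tensor

Cell topic `Summits/ResolutionOfSingularities/KangarooAtlas` (pub-rosobs); namespace
`Summit.ResolutionOfSingularities.KangarooAtlas.Mizutani`.  Part of the Lean transcription of the
in-house note MIZUTANI-PROOF-g59 (AI-written, AI-audited; *AI review is weaker than expert review*; not a
resolution theorem).  §3 DICTIONARY, step (D) = the note's §3 (e) "REDUCTION TO RANK" (reduced echelon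
bases), in a basis-free form:

* **`exists_small_support`** — if `P' ⊆ P` are subspaces of `F^ι` and `v ∈ P ∖ P'`, then some `w ∈ P ∖ P'`
  has at most `codim P + 1` nonzero coordinates (induction on the support: a subspace of codimension `c`
  meeting a coordinate subspace of dimension `≥ c + 2` in dimension `≥ 2` allows one coordinate to be
  cancelled on either summand of `v = (v − t w) + t w`);
* **`tensorRank_sum_tmul_le_card`** — `rank_L (Σ_{i ∈ s} v_i ⊗ c_i) ≤ #s` (the right support is spanned
  by the `c_i`; `MizutaniRank.rightSupport_le_of_mem_range`).

Together: a coefficient vector with `≤ c + 1` nonzero entries gives tensors `Σ_i a_i ⊗ c_{ij}` of rank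
`≤ c + 1`, which THEOREM F bounds below by `2q` when genuine.

References: [Mizutani1973HironakaGroupSchemes] Remark 2.10 (in-house proof §3 (e));
[Oda1983HironakaGroupSchemeII] Cor. 2.3 (dim B = codim V).
-/

open TensorProduct

namespace Summit.ResolutionOfSingularities.KangarooAtlas.Mizutani

/-! ## Support reduction in `F^ι` -/

section Support

variable {F : Type*} [Field F] {ι : Type*} [Fintype ι] [DecidableEq ι]

open Classical in
/-- The support of a vector as a finset. [folklore] -/
noncomputable def fsupp (v : ι → F) : Finset ι := Finset.univ.filter fun i => v i ≠ 0

omit [DecidableEq ι] in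
open Classical in
/-- Membership in the support. [folklore] -/
@[simp] theorem mem_fsupp {v : ι → F} {i : ι} : i ∈ fsupp v ↔ v i ≠ 0 := by
  unfold fsupp; simp

/-- A subspace `P` of `F^ι` contains, for `#S ≥ codim P + 2` and `i₀ ∈ S`... more precisely: the vectors of `P`
supported in `S` and vanishing at `i₀` form a subspace of dimension `≥ #S − codim P − 1`; here we only record
the existence of a NONZERO such vector when `#S ≥ (card ι − dim P) + 2`. [folklore] -/
theorem exists_mem_supported_ne_zero (P : Submodule F (ι → F)) (S : Finset ι) (i₀ : ι)
    (hS : Fintype.card ι - Module.finrank F P + 2 ≤ S.card) :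
    ∃ w ∈ P, w ≠ 0 ∧ w i₀ = 0 ∧ ∀ i, i ∉ S → w i = 0 := by
  classical
  -- the restriction map `P → F^{Sᶜ} × F`, `w ↦ ((w i)_{i ∉ S}, w i₀)`
  set r : P →ₗ[F] ({i // i ∉ S} → F) × F :=
    LinearMap.prod ((LinearMap.funLeft F F ((↑) : {i // i ∉ S} → ι)).comp P.subtype)
      ((LinearMap.proj i₀).comp P.subtype) with hr
  have hrank := LinearMap.finrank_range_add_finrank_ker r
  have hrange : Module.finrank F (LinearMap.range r) ≤ Fintype.card {i // i ∉ S} + 1 := by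
    calc Module.finrank F (LinearMap.range r) ≤ Module.finrank F (({i // i ∉ S} → F) × F) :=
          Submodule.finrank_le _
      _ = Fintype.card {i // i ∉ S} + 1 := by
          rw [Module.finrank_prod, Module.finrank_pi, Module.finrank_self]
  have hcompl : Fintype.card {i // i ∉ S} = Fintype.card ι - S.card := by
    rw [Fintype.card_subtype_compl, Fintype.card_coe]
  have hP : Module.finrank F P ≤ Fintype.card ι := by
    calc Module.finrank F P ≤ Module.finrank F (ι → F) := Submodule.finrank_le P
      _ = Fintype.card ι := Module.finrank_pi F
  have hSle : S.card ≤ Fintype.card ι := by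
    calc S.card ≤ (Finset.univ : Finset ι).card := Finset.card_le_card (Finset.subset_univ S)
      _ = Fintype.card ι := Finset.card_univ
  have hker : 1 ≤ Module.finrank F (LinearMap.ker r) := by omega
  have hne : LinearMap.ker r ≠ ⊥ := by
    intro h
    rw [h, finrank_bot] at hker
    exact Nat.not_succ_le_zero 0 hker
  obtain ⟨w, hw, hw0⟩ := Submodule.exists_mem_ne_zero_of_ne_bot hne
  rw [LinearMap.mem_ker, hr, LinearMap.prod_apply, Prod.mk_eq_zero] at hw
  refine ⟨(w : ι → F), w.2, fun h => hw0 (Subtype.ext h), ?_, fun i hi => ?_⟩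
  · simpa using hw.2
  · have := congrFun hw.1 ⟨i, hi⟩
    simpa [LinearMap.funLeft_apply] using this

/-- **Support reduction**: if `v ∈ P ∖ P'` (`P' ≤ P` not needed) then some `w ∈ P ∖ P'` has at most
`(card ι − dim P) + 1` nonzero coordinates (the note's reduced echelon basis, §3 (e)).
[cite: Mizutani1973HironakaGroupSchemes, Remark 2.10 (in-house proof §3 (e): "each r_j has at most n − d + 1 nonzero coordinates")] -/
theorem exists_small_support (P P' : Submodule F (ι → F)) :
    ∀ (N : ℕ) (v : ι → F), (fsupp v).card ≤ N → v ∈ P → v ∉ P' →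
      ∃ w ∈ P, w ∉ P' ∧ (fsupp w).card ≤ Fintype.card ι - Module.finrank F P + 1 := by
  intro N
  induction N with
  | zero =>
    intro v hv hvP hvP'
    exact ⟨v, hvP, hvP', by omega⟩
  | succ N ih =>
    intro v hv hvP hvP'
    by_cases hsmall : (fsupp v).card ≤ Fintype.card ι - Module.finrank F P + 1
    · exact ⟨v, hvP, hvP', hsmall⟩
    -- the support `S` is large: find `w ∈ P`, `w ≠ 0`, supported in `S`, vanishing at some `i₀ ∈ S`
    set S := fsupp v with hS
    have hSbig : Fintype.card ι - Module.finrank F P + 2 ≤ S.card := by omega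
    have hSne : S.Nonempty := Finset.card_pos.mp (by omega)
    obtain ⟨i₀, hi₀⟩ := hSne
    obtain ⟨w, hwP, hw0, hwi₀, hwS⟩ := exists_mem_supported_ne_zero P S i₀ hSbig
    -- `w` has a nonzero coordinate `i₁ ∈ S`
    obtain ⟨i₁, hi₁⟩ : ∃ i₁, w i₁ ≠ 0 := by
      by_contra h
      push Not at h
      exact hw0 (funext h)
    have hi₁S : i₁ ∈ S := by
      by_contra h; exact hi₁ (hwS i₁ h)
    -- supports of `w` and of `v − t w` are strictly smaller than `S`
    have hwsupp : fsupp w ⊆ S.erase i₀ := by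
      intro i hi
      rw [mem_fsupp] at hi
      rw [Finset.mem_erase]
      refine ⟨fun h => hi (h ▸ hwi₀), ?_⟩
      by_contra h; exact hi (hwS i h)
    have hwcard : (fsupp w).card ≤ N := by
      have := Finset.card_le_card hwsupp
      rw [Finset.card_erase_of_mem hi₀] at this
      omega
    set t := v i₁ / w i₁ with ht
    set v' := v - t • w with hv'
    have hv'supp : fsupp v' ⊆ S.erase i₁ := by
      intro i hi
      rw [mem_fsupp, hv', Pi.sub_apply, Pi.smul_apply, smul_eq_mul] at hi
      rw [Finset.mem_erase]
      constructor
      · rintro rfl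
        rw [ht, div_mul_cancel₀ _ hi₁, sub_self] at hi
        exact hi rfl
      · by_contra h
        have hv0 : v i = 0 := by simpa [hS, mem_fsupp] using h
        rw [hv0, hwS i h, mul_zero, sub_zero] at hi
        exact hi rfl
    have hv'card : (fsupp v').card ≤ N := by
      have := Finset.card_le_card hv'supp
      rw [Finset.card_erase_of_mem hi₁S] at this
      omega
    have hv'P : v' ∈ P := P.sub_mem hvP (P.smul_mem t hwP)
    -- `v = v' + t • w ∉ P'`: one of the summands is outside `P'`
    by_cases hv'P' : v' ∈ P'
    · have hwP' : w ∉ P' := by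
        intro h
        apply hvP'
        have : v = v' + t • w := by rw [hv', sub_add_cancel]
        rw [this]
        exact P'.add_mem hv'P' (P'.smul_mem t h)
      exact ih w hwcard hwP hwP'
    · exact ih v' hv'card hv'P hv'P'

/-- **Support reduction, packaged**: for subspaces `P' , P` of `F^ι` with some `v ∈ P ∖ P'`, there is
`w ∈ P ∖ P'` with `#supp(w) ≤ (card ι − dim P) + 1`. [cite: Mizutani1973HironakaGroupSchemes, Remark 2.10 (in-house proof §3 (e))] -/
theorem exists_small_support' (P P' : Submodule F (ι → F)) {v : ι → F} (hvP : v ∈ P) (hvP' : v ∉ P') :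
    ∃ w ∈ P, w ∉ P' ∧ (fsupp w).card ≤ Fintype.card ι - Module.finrank F P + 1 :=
  exists_small_support P P' _ v le_rfl hvP hvP'

end Support

/-! ## The rank of a short tensor -/

section ShortTensor

variable (L : Type*) {E : Type*} [Field L] [Field E] [Algebra L E]

/-- **`rank_L(Σ_{i∈s} v_i ⊗ c_i) ≤ #s`**: the right support of a sum of `#s` pure tensors is spanned by the
right entries (MIZUTANI-PROOF-g59 §3 (e): "`r_j = Σ_l c_{jl} ⊗ h_l` with `≤ n − d + 1` terms, so
`rank(r_j) ≤ n − d + 1`"). [cite: Mizutani1973HironakaGroupSchemes, Remark 2.10 (in-house proof §1.3 / §3 (e))] -/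
theorem tensorRank_sum_tmul_le_card {ι : Type*} (s : Finset ι) (v c : ι → E) :
    tensorRank L (∑ i ∈ s, v i ⊗ₜ[L] c i) ≤ s.card := by
  classical
  set H : Submodule L E := Submodule.span L ((s.image c : Finset E) : Set E) with hH
  have hmem : (∑ i ∈ s, v i ⊗ₜ[L] c i) ∈ LinearMap.range (H.subtype.lTensor E) := by
    refine Submodule.sum_mem _ fun i hi => ?_
    have hci : c i ∈ H := Submodule.subset_span (by
      rw [Finset.coe_image]; exact ⟨i, Finset.mem_coe.mpr hi, rfl⟩)
    exact ⟨v i ⊗ₜ ⟨c i, hci⟩, by rw [LinearMap.lTensor_tmul, Submodule.subtype_apply]⟩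
  have hle := rightSupport_le_of_mem_range (L := L) _ H hmem
  haveI : FiniteDimensional L H := FiniteDimensional.span_finset L (s.image c)
  calc tensorRank L (∑ i ∈ s, v i ⊗ₜ[L] c i) = Module.finrank L (rightSupport L (∑ i ∈ s, v i ⊗ₜ[L] c i)) := rfl
    _ ≤ Module.finrank L H := Submodule.finrank_mono hle
    _ ≤ (s.image c).card := finrank_span_finset_le_card (s.image c)
    _ ≤ s.card := Finset.card_image_le

end ShortTensor

end Summit.ResolutionOfSingularities.KangarooAtlas.Mizutani
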